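import Mathlib
import Summits.CriticalPhenomena.CardyFormulaZ2.Theorems.CardyMagicRigidityNestingRigiditySmearedCentringZ2
import HarnessLib

/-!
# Band centring on bond-`ℤ²`: smeared exact centring within an isometry-invariant family of loops
# (crux `MagicFormulaT`, line `Sketch` v6, stub `stub_bandCentring`, `zEns` half)

Crux `Summit.CriticalPhenomena.CardyFormulaZ2.Theses.CardyMagicRigidity.MagicFormulaT`
(stmt-CriticalPhenomena-4836), line `Sketch`, stub S3 `stub_bandCentring` ("exact centring of the
phase sum over the loops of diameter `< η`, at every mesh, both lattices"), bond-`ℤ²` half: the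
FAMILY version of keystone K3 `smearedCentring_zEns` (`…NestingRigiditySmearedCentringZ2`).

**Theorem (`bc_integral_finsum_nestingPhase_eq_zero_zEns`).** For every family `T` of unbased
loops invariant under the isometric push-forwards `u ↦ u.map φ` and under time reversal, every
admissible neutral density `f` (measurable, `|f| ≤ C`, `f = 0` off `‖z‖ ≤ R`, `∫ f = 0`) and every
mesh `δ > 0`, `E_{1/2}[Σ_{u ∈ loops(X_δ ω) ∩ T} ∫_{W(u,·) ≠ 0} f] = 0`; in particular for the
small loops `T = {u | diam u < η}` (`bc_bandCentring_zEns`).  Proof: the assembly of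
`…SmearedCentringZ2` with the family threaded through — cell bridge loop by loop
(`nestingPhase_eq_sum_cells`) and neutral cell charges; dipole decomposition within the family
(`bc_finsum_phase_eq_sum_ncard`: `Σ_{u ∈ T} θ_u = Σ_F λ_F (N^T_{F∖F₀} − N^T_{F₀∖F})`); dipole
symmetry within the family (`bc_integral_ncard_dipT_symm_cellCenter`): the point reflections of
`ℤ²` (`…BondReflection`) and the duality map `u ↦ (u + δ(1+i)/2).reverse`
(`…SmearedCentringZ2Dipole`) are isometries / reversals of the loops, so they preserve `T` and the
family-restricted dipole sets correspond (`bc_ncard_dipT_map_pointReflect`, `bc_ncard_dipT_dualConfig`).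
No definition (`dipT[L, T, x, y]`, `T[b]`, `S[p]` are local notations), no cited fact.
-/
noncomputable section

open MeasureTheory Set Filter Metric
open scoped Real Topology BigOperators

namespace Summit.CriticalPhenomena.CardyFormulaZ2.Cruxes.MagicFormulaT.LineSketch

open Literature.Probability.RandomPlanarGeometry Literature.Probability.Percolation
  Literature.Probability.LatticeModels
open Summit.CriticalPhenomena.CardyFormulaZ2.Cruxes.NestingRigidity.RingCloudTomography
open Summit.CriticalPhenomena.CardyFormulaZ2.Cruxes.NestingRigidity.MarkovCascadeOneGeneration
  (continuous_translate isometry_translate wind_map_translate)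

section BandCentringZ2

/-- The translation `z ↦ z + b` of the plane as a continuous map (local notation). -/
local notation3 "T[" b "]" => (⟨fun z : ℂ ↦ 1 * z + (b : ℂ), continuous_translate b⟩ : C(ℂ, ℂ))

/-- The point reflection `z ↦ −z + p` of the plane as a continuous map (local notation). -/
local notation3 "S[" p "]" =>
  (⟨fun z : ℂ ↦ -1 * z + (p : ℂ), BondReflection.continuous_pointReflect p⟩ : C(ℂ, ℂ))

/-- The loops of a family `L` that belong to `T`, wind around `x` and not around `y` (local
notation, not a definition). -/
local notation3 (prettyPrint := false) "dipT[" L ", " T ", " x ", " y "]" =>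
  {u : UnbasedLoop ℂ | u ∈ (L : Set (UnbasedLoop ℂ)) ∧ u ∈ (T : Set (UnbasedLoop ℂ)) ∧
    u.wind x ≠ 0 ∧ u.wind y = 0}

variable {T : Set (UnbasedLoop ℂ)}

/-! ## §1 Family-restricted separating loops: finitely many, measurable and integrable counts -/

/-- The family-restricted separating loops are separating loops. -/
theorem bc_dipT_subset (L T : Set (UnbasedLoop ℂ)) (x y : ℂ) :
    dipT[L, T, x, y] ⊆ {u | u ∈ L ∧ u.wind x ≠ 0 ∧ u.wind y = 0} :=
  fun _ hu ↦ ⟨hu.1, hu.2.2⟩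

/-- **The family-restricted separating loops of `zEns` are finitely many, uniformly in `ω`**. -/
theorem bc_dipT_finite_ncard_le (T : Set (UnbasedLoop ℂ)) {δ : ℝ} (hδ : 0 < δ) (ω : zEns.Ω)
    {x y : ℂ} {ρ : ℝ} (hx : ‖x‖ ≤ ρ) (hy : ‖y‖ ≤ ρ) :
    (dipT[(zEns.X δ ω).loops, T, x, y]).Finite ∧
      (dipT[(zEns.X δ ω).loops, T, x, y]).ncard ≤
        (finite_setOf_corner_norm_le hδ (ρ + |δ|)).toFinset.card := by
  obtain ⟨hfin, hle⟩ := SmearedCentringZ2.sep_finite_ncard_le hδ ω hx hy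
  have hsub := bc_dipT_subset (zEns.X δ ω).loops T x y
  exact ⟨hfin.subset hsub, (Set.ncard_le_ncard hsub hfin).trans hle⟩

/-- **The family-restricted dipole counts of `zEns` are measurable** (countable index
presentation of the loops, `measurable_ncard_image_sep`). -/
theorem bc_measurable_ncard_dipT (T : Set (UnbasedLoop ℂ)) (δ : ℝ) (x y : ℂ) :
    Measurable fun ω : BondConfig (Site 2) ↦ ((dipT[(zEns.X δ ω).loops, T, x, y]).ncard : ℝ) := by
  have h : Measurable fun ω : BondConfig (Site 2) ↦ (dipT[(zEns.X δ ω).loops, T, x, y]).ncard := by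
    simp_rw [loops_zEns_eq_image]
    exact measurable_ncard_image_sep _ measurable_mem_bondIndex _
  exact measurable_from_nat.comp h

/-- The family-restricted dipole counts are integrable (bounded and measurable). -/
theorem bc_integrable_ncard_dipT (T : Set (UnbasedLoop ℂ)) {δ : ℝ} (hδ : 0 < δ) (x y : ℂ) :
    Integrable (fun ω ↦ ((dipT[(zEns.X δ ω).loops, T, x, y]).ncard : ℝ)) zEns.P := by
  haveI : IsProbabilityMeasure zEns.P :=
    inferInstanceAs (IsProbabilityMeasure (bondPercolation (zdGraph 2) half))
  refine Integrable.of_mem_Icc 0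
    ((finite_setOf_corner_norm_le hδ (max ‖x‖ ‖y‖ + |δ|)).toFinset.card : ℝ)
    (bc_measurable_ncard_dipT T δ x y).aemeasurable
    (Eventually.of_forall fun ω ↦ ⟨Nat.cast_nonneg _, ?_⟩)
  exact_mod_cast (bc_dipT_finite_ncard_le T hδ ω (le_max_left _ _) (le_max_right _ _)).2

/-! ## §2 The lattice symmetries preserve the family-restricted dipole counts -/

/-- **Family-restricted dipole counts under duality**: for a family `T` invariant under isometric
push-forwards and reversal, the loops of `T` of the dual configuration winding around `x` and not
around `y` are as many as the loops of `T` of `ω` winding around `x + δ(1+i)/2` and not around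
`y + δ(1+i)/2`. -/
theorem bc_ncard_dipT_dualConfig
    (hT : ∀ (φ : C(ℂ, ℂ)) (hφ : Isometry φ) (u : UnbasedLoop ℂ), u.map φ hφ ∈ T ↔ u ∈ T)
    (hTr : ∀ u : UnbasedLoop ℂ, u.reverse ∈ T ↔ u ∈ T) {δ : ℝ} {ω : BondConfig (Site 2)}
    (hω : ω ⊆ (zdGraph 2).edgeSet) (x y : ℂ) :
    (dipT[(bondLoopConfig δ 0 (dualConfig ω)).loops, T, x, y]).ncard =
      (dipT[(bondLoopConfig δ 0 ω).loops, T, x + δ * (1 + Complex.I) / 2,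
        y + δ * (1 + Complex.I) / 2]).ncard := by
  set p : ℂ := δ * (1 + Complex.I) / 2 with hp
  set Ψ : UnbasedLoop ℂ → UnbasedLoop ℂ := fun u ↦ (u.map T[p] (isometry_translate p)).reverse
    with hΨ
  have hwind : ∀ (u : UnbasedLoop ℂ) (z : ℂ), (Ψ u).wind (z + p) = -u.wind z := fun u z ↦ by
    rw [hΨ, UnbasedLoop.wind_reverse, wind_map_translate]
  have hΨT : ∀ u, Ψ u ∈ T ↔ u ∈ T := fun u ↦ (hTr _).trans (hT _ _ u)
  have hinj : Function.Injective Ψ := fun u v h ↦ by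
    have h' := congrArg UnbasedLoop.reverse h
    simp only [hΨ, UnbasedLoop.reverse_reverse] at h'
    exact BondTranslation.map_translate_injective p h'
  have hsurj : ∀ v : UnbasedLoop ℂ, Ψ ((v.map T[-p] (isometry_translate (-p))).reverse) = v := fun v ↦ by
    simp only [hΨ]
    rw [← UnbasedLoop.reverse_map, UnbasedLoop.reverse_reverse, SmearedCentringZ2.map_translate_neg_map_translate]
  have himage : Ψ '' dipT[(bondLoopConfig δ 0 (dualConfig ω)).loops, T, x, y] =
      dipT[(bondLoopConfig δ 0 ω).loops, T, x + p, y + p] := by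
    ext v
    constructor
    · rintro ⟨u, ⟨hu, huT, hx, hy⟩, rfl⟩
      refine ⟨(SmearedCentringZ2.mem_loops_dualConfig_iff hω u).1 hu, (hΨT u).2 huT, ?_, ?_⟩
      · rw [hwind]; exact neg_ne_zero.2 hx
      · rw [hwind, hy, neg_zero]
    · rintro ⟨hv, hvT, hx, hy⟩
      refine ⟨(v.map T[-p] (isometry_translate (-p))).reverse, ⟨?_, ?_, ?_, ?_⟩, hsurj v⟩
      · refine (SmearedCentringZ2.mem_loops_dualConfig_iff hω _).2 ?_
        change Ψ ((v.map T[-p] (isometry_translate (-p))).reverse) ∈ (bondLoopConfig δ 0 ω).loops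
        rw [hsurj]; exact hv
      · rw [← hΨT, hsurj]; exact hvT
      · have h := hwind ((v.map T[-p] (isometry_translate (-p))).reverse) x
        rw [hsurj] at h
        intro h0
        rw [h0, neg_zero] at h
        exact hx h
      · have h := hwind ((v.map T[-p] (isometry_translate (-p))).reverse) y
        rw [hsurj, hy] at h
        exact neg_eq_zero.1 h.symm
  rw [← himage, Set.ncard_image_of_injective _ hinj]

/-- **The mean family-restricted dipole counts of `zEns` are invariant under the half-diagonal
shift `δ(1+i)/2`** (self-duality of `P_{1/2}`). -/
theorem bc_integral_ncard_dipT_halfShift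
    (hT : ∀ (φ : C(ℂ, ℂ)) (hφ : Isometry φ) (u : UnbasedLoop ℂ), u.map φ hφ ∈ T ↔ u ∈ T)
    (hTr : ∀ u : UnbasedLoop ℂ, u.reverse ∈ T ↔ u ∈ T) (δ : ℝ) (x y : ℂ) :
    ∫ ω, ((dipT[(zEns.X δ ω).loops, T, x, y]).ncard : ℝ) ∂zEns.P =
      ∫ ω, ((dipT[(zEns.X δ ω).loops, T, x + δ * (1 + Complex.I) / 2,
        y + δ * (1 + Complex.I) / 2]).ncard : ℝ) ∂zEns.P := by
  rw [← SmearedCentringZ2.integral_comp_dualConfig_zEns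
    (bc_measurable_ncard_dipT T δ x y).aestronglyMeasurable]
  refine integral_congr_ae ?_
  change ∀ᵐ ω ∂(bondPercolation (zdGraph 2) half), _
  filter_upwards [ae_subset_edgeSet (zdGraph 2) half] with ω hω
  change ((dipT[(bondLoopConfig δ 0 (dualConfig ω)).loops, T, x, y]).ncard : ℝ) =
    ((dipT[(bondLoopConfig δ 0 ω).loops, T, x + δ * (1 + Complex.I) / 2,
      y + δ * (1 + Complex.I) / 2]).ncard : ℝ)
  rw [bc_ncard_dipT_dualConfig hT hTr hω x y]

/-- Pathwise: among the reflected loops, the loops of `T` winding around `x` and not around `y`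
are the reflections of the loops of `T` winding around `−x + p` and not around `−y + p`. -/
theorem bc_ncard_dipT_map_pointReflect
    (hT : ∀ (φ : C(ℂ, ℂ)) (hφ : Isometry φ) (u : UnbasedLoop ℂ), u.map φ hφ ∈ T ↔ u ∈ T)
    (p x y : ℂ) (L : Set (UnbasedLoop ℂ)) :
    (dipT[UnbasedLoop.map S[p] (BondReflection.isometry_pointReflect p) '' L, T, x, y]).ncard =
      (dipT[L, T, -1 * x + p, -1 * y + p]).ncard := by
  have h : dipT[UnbasedLoop.map S[p] (BondReflection.isometry_pointReflect p) '' L, T, x, y] =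
      UnbasedLoop.map S[p] (BondReflection.isometry_pointReflect p) ''
        dipT[L, T, -1 * x + p, -1 * y + p] := by
    ext u
    constructor
    · rintro ⟨⟨v, hv, rfl⟩, hvT, hq⟩
      exact ⟨v, ⟨hv, (hT _ _ v).1 hvT, by
        rwa [BondReflection.wind_map_pointReflect', BondReflection.wind_map_pointReflect'] at hq⟩,
        rfl⟩
    · rintro ⟨v, ⟨hv, hvT, hq⟩, rfl⟩
      exact ⟨⟨v, hv, rfl⟩, (hT _ _ v).2 hvT, by
        rwa [BondReflection.wind_map_pointReflect', BondReflection.wind_map_pointReflect']⟩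
  rw [h, Set.ncard_image_of_injective _ (BondReflection.map_pointReflect_injective p)]

/-- **The mean family-restricted dipole counts of `zEns` are invariant under the point
reflections `z ↦ −z + δc`, `c ∈ ℤ²`.** -/
theorem bc_integral_ncard_dipT_reflect
    (hT : ∀ (φ : C(ℂ, ℂ)) (hφ : Isometry φ) (u : UnbasedLoop ℂ), u.map φ hφ ∈ T ↔ u ∈ T)
    (δ : ℝ) (c : Site 2) (x y : ℂ) :
    ∫ ω, ((dipT[(zEns.X δ ω).loops, T, x, y]).ncard : ℝ) ∂zEns.P =
      ∫ ω, ((dipT[(zEns.X δ ω).loops, T, -1 * x + meshPoint δ c,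
        -1 * y + meshPoint δ c]).ncard : ℝ) ∂zEns.P := by
  rw [← BondReflection.integral_comp_relabel_reflect_zEns c
    fun ω ↦ ((dipT[(zEns.X δ ω).loops, T, x, y]).ncard : ℝ)]
  refine integral_congr_ae (Eventually.of_forall fun ω ↦ ?_)
  simp only [BondReflection.loops_zEns_relabel_reflect, bc_ncard_dipT_map_pointReflect hT]

/-- **Same-class dipole symmetry within the family**: for `x + y ∈ δℤ²`,
`E N^T_{x∖y} = E N^T_{y∖x}` (point reflection through the midpoint). -/
theorem bc_integral_ncard_dipT_symm_same
    (hT : ∀ (φ : C(ℂ, ℂ)) (hφ : Isometry φ) (u : UnbasedLoop ℂ), u.map φ hφ ∈ T ↔ u ∈ T)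
    (δ : ℝ) (c : Site 2) {x y : ℂ} (hxy : x + y = meshPoint δ c) :
    ∫ ω, ((dipT[(zEns.X δ ω).loops, T, x, y]).ncard : ℝ) ∂zEns.P =
      ∫ ω, ((dipT[(zEns.X δ ω).loops, T, y, x]).ncard : ℝ) ∂zEns.P := by
  rw [bc_integral_ncard_dipT_reflect hT δ c x y]
  have hx : -1 * x + meshPoint δ c = y := by rw [← hxy]; ring
  have hy : -1 * y + meshPoint δ c = x := by rw [← hxy]; ring
  rw [hx, hy]

/-- **Cross-class dipole symmetry within the family**: for `x + y + δ(1+i)/2 ∈ δℤ²`,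
`E N^T_{x∖y} = E N^T_{y∖x}` (half-diagonal shift by duality, then a point reflection). -/
theorem bc_integral_ncard_dipT_symm_cross
    (hT : ∀ (φ : C(ℂ, ℂ)) (hφ : Isometry φ) (u : UnbasedLoop ℂ), u.map φ hφ ∈ T ↔ u ∈ T)
    (hTr : ∀ u : UnbasedLoop ℂ, u.reverse ∈ T ↔ u ∈ T) (δ : ℝ) (c : Site 2) {x y : ℂ}
    (hxy : x + y + δ * (1 + Complex.I) / 2 = meshPoint δ c) :
    ∫ ω, ((dipT[(zEns.X δ ω).loops, T, x, y]).ncard : ℝ) ∂zEns.P =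
      ∫ ω, ((dipT[(zEns.X δ ω).loops, T, y, x]).ncard : ℝ) ∂zEns.P := by
  rw [bc_integral_ncard_dipT_halfShift hT hTr δ x y, bc_integral_ncard_dipT_reflect hT δ c]
  have hx : -1 * (x + δ * (1 + Complex.I) / 2) + meshPoint δ c = y := by rw [← hxy]; ring
  have hy : -1 * (y + δ * (1 + Complex.I) / 2) + meshPoint δ c = x := by rw [← hxy]; ring
  rw [hx, hy]

/-- **Dipole symmetry within the family between any two medial cell centres of `δℤ²`**:
`E N^T_{F∖F'} = E N^T_{F'∖F}` for all cells `F, F' ∈ ℤ × ℤ`, by parity of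
`F.1 + F.2 + F'.1 + F'.2` (same class: reflection; cross class: duality and reflection). -/
theorem bc_integral_ncard_dipT_symm_cellCenter
    (hT : ∀ (φ : C(ℂ, ℂ)) (hφ : Isometry φ) (u : UnbasedLoop ℂ), u.map φ hφ ∈ T ↔ u ∈ T)
    (hTr : ∀ u : UnbasedLoop ℂ, u.reverse ∈ T ↔ u ∈ T) (δ : ℝ) (F F' : ℤ × ℤ) :
    ∫ ω, ((dipT[(zEns.X δ ω).loops, T, (δ : ℂ) * cellCenter F,
        (δ : ℂ) * cellCenter F']).ncard : ℝ) ∂zEns.P =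
      ∫ ω, ((dipT[(zEns.X δ ω).loops, T, (δ : ℂ) * cellCenter F',
        (δ : ℂ) * cellCenter F]).ncard : ℝ) ∂zEns.P := by
  rcases Int.emod_two_eq_zero_or_one (F.1 + F.2 + F'.1 + F'.2) with h2 | h2
  · -- same class: `x + y ∈ δℤ²`
    obtain ⟨k, hk⟩ : ∃ k, F.1 - F.2 + F'.1 - F'.2 + 2 = 2 * k := ⟨(F.1 - F.2 + F'.1 - F'.2 + 2) / 2, by omega⟩
    obtain ⟨l, hl⟩ : ∃ l, F.1 + F.2 + F'.1 + F'.2 + 2 = 2 * l := ⟨(F.1 + F.2 + F'.1 + F'.2 + 2) / 2, by omega⟩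
    refine bc_integral_ncard_dipT_symm_same hT δ ![k, l] ?_
    have hk' : (F.1 : ℝ) - F.2 + F'.1 - F'.2 + 2 = 2 * k := by exact_mod_cast hk
    have hl' : (F.1 : ℝ) + F.2 + F'.1 + F'.2 + 2 = 2 * l := by exact_mod_cast hl
    apply Complex.ext
    · simp [cellCenter, meshPoint_re]
      linear_combination (δ / 2) * hk'
    · simp [cellCenter, meshPoint_im]
      linear_combination (δ / 2) * hl'
  · -- cross class: `x + y + δ(1+i)/2 ∈ δℤ²`
    obtain ⟨k, hk⟩ : ∃ k, F.1 - F.2 + F'.1 - F'.2 + 3 = 2 * k := ⟨(F.1 - F.2 + F'.1 - F'.2 + 3) / 2, by omega⟩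
    obtain ⟨l, hl⟩ : ∃ l, F.1 + F.2 + F'.1 + F'.2 + 3 = 2 * l := ⟨(F.1 + F.2 + F'.1 + F'.2 + 3) / 2, by omega⟩
    refine bc_integral_ncard_dipT_symm_cross hT hTr δ ![k, l] ?_
    have hk' : (F.1 : ℝ) - F.2 + F'.1 - F'.2 + 3 = 2 * k := by exact_mod_cast hk
    have hl' : (F.1 : ℝ) + F.2 + F'.1 + F'.2 + 3 = 2 * l := by exact_mod_cast hl
    apply Complex.ext
    · simp [cellCenter, meshPoint_re]
      linear_combination (δ / 2) * hk'
    · simp [cellCenter, meshPoint_im]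
      linear_combination (δ / 2) * hl'

/-! ## §3 The phase sum over the family as a combination of family-restricted dipole counts -/

/-- **The neutral phase sum of a configuration of `zEns` (`δ > 0`) over a family of loops is a
combination of family-restricted dipole counts**: `Σ_{u ∈ T} θ_u = Σ_x λ_x (N^T_{x∖x₀} − N^T_{x₀∖x})`,
an identity between finite sums (only the finitely many loops meeting a ball containing the
centres contribute). -/
theorem bc_finsum_phase_eq_sum_ncard {ι : Type*} (T : Set (UnbasedLoop ℂ)) {δ : ℝ} (hδ : 0 < δ)
    (ω : zEns.Ω) (S : Finset ι) (c : ι → ℂ) (lam : ι → ℝ) (x₀ : ι) (h0 : ∑ x ∈ S, lam x = 0) :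
    (∑ᶠ u ∈ (zEns.X δ ω).loops ∩ T, ∑ x ∈ S, if u.wind (c x) ≠ 0 then lam x else 0) =
      ∑ x ∈ S, lam x * (((dipT[(zEns.X δ ω).loops, T, c x, c x₀]).ncard : ℝ) -
        ((dipT[(zEns.X δ ω).loops, T, c x₀, c x]).ncard : ℝ)) := by
  classical
  -- a ball containing all the centres
  set ρ : ℝ := ∑ x ∈ insert x₀ S, ‖c x‖ with hρ
  have hρx : ∀ x ∈ insert x₀ S, ‖c x‖ ≤ ρ := fun x hx ↦
    Finset.single_le_sum (f := fun x ↦ ‖c x‖) (fun _ _ ↦ norm_nonneg _) hx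
  have hρ0 : ‖c x₀‖ ≤ ρ := hρx x₀ (Finset.mem_insert_self _ _)
  have hρS : ∀ x ∈ S, ‖c x‖ ≤ ρ := fun x hx ↦ hρx x (Finset.mem_insert_of_mem hx)
  -- the finite set of loops of the family meeting it
  obtain ⟨hMfin, -⟩ := ncard_loops_meeting_le hδ ρ ω
  set M : Finset (UnbasedLoop ℂ) := hMfin.toFinset.filter (· ∈ T) with hM
  have hmemM : ∀ u, u ∈ (↑M : Set (UnbasedLoop ℂ)) ↔ (u ∈ (zEns.X δ ω).loops ∧
      (u.range ∩ closedBall (0 : ℂ) ρ).Nonempty) ∧ u ∈ T := fun u ↦ by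
    rw [hM, Finset.coe_filter, Set.mem_setOf_eq, Set.Finite.mem_toFinset, Set.mem_setOf_eq]
    rfl
  have hMsub : (↑M : Set (UnbasedLoop ℂ)) ⊆ (zEns.X δ ω).loops ∩ T := fun u hu ↦
    ⟨((hmemM u).1 hu).1.1, ((hmemM u).1 hu).2⟩
  -- the phase sum is a sum over `M`
  have hsupp : ((zEns.X δ ω).loops ∩ T) ∩ Function.support
      (fun u ↦ ∑ x ∈ S, if u.wind (c x) ≠ 0 then lam x else 0) ⊆ ↑M := by
    rintro u ⟨⟨hu, huT⟩, hne⟩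
    rw [hmemM]
    refine ⟨⟨hu, ?_⟩, huT⟩
    by_contra hdisj
    rw [Set.not_nonempty_iff_eq_empty] at hdisj
    have hdisj' : Disjoint (closedBall (0 : ℂ) ρ) u.range := by
      rw [Set.disjoint_iff_inter_eq_empty, Set.inter_comm, hdisj]
    -- the winding number is constant on the ball, so the phase is `𝟙 · Σ λ = 0`
    have hconst : ∀ x ∈ S, u.wind (c x) = u.wind (c x₀) := fun x hx ↦
      unbasedLoop_wind_eq_of_isPreconnected u (convex_closedBall (0 : ℂ) ρ).isPreconnected hdisj'
        (mem_closedBall_zero_iff.2 (hρS x hx)) (mem_closedBall_zero_iff.2 hρ0)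
    apply hne
    change (∑ x ∈ S, if u.wind (c x) ≠ 0 then lam x else 0) = 0
    have hsum : (∑ x ∈ S, if u.wind (c x) ≠ 0 then lam x else 0) =
        ∑ x ∈ S, if u.wind (c x₀) ≠ 0 then lam x else 0 :=
      Finset.sum_congr rfl fun x hx ↦ by rw [hconst x hx]
    rw [hsum]
    rcases eq_or_ne (u.wind (c x₀)) 0 with h | h
    · simp [h]
    · simp [h, h0]
  rw [finsum_mem_eq_sum_of_subset _ hsupp hMsub]
  -- rewrite each phase as a combination of dipole indicators and swap the sums
  simp_rw [SmearedCentringZ2.phase_eq_sum_dipole _ S c lam x₀ h0]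
  rw [Finset.sum_comm]
  refine Finset.sum_congr rfl fun x hx ↦ ?_
  rw [← Finset.mul_sum, Finset.sum_sub_distrib]
  have hfilter : ∀ a b : ℂ, ‖a‖ ≤ ρ → ‖b‖ ≤ ρ →
      dipT[(zEns.X δ ω).loops, T, a, b] = ↑(M.filter fun u ↦ u.wind a ≠ 0 ∧ u.wind b = 0) := by
    intro a b ha hb
    rw [Finset.coe_filter]
    ext u
    constructor
    · intro hu
      have huM : u ∈ (↑M : Set (UnbasedLoop ℂ)) := by
        rw [hmemM]
        exact ⟨SmearedCentringZ2.sep_subset_meeting δ ω ha hb ⟨hu.1, hu.2.2⟩, hu.2.1⟩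
      exact ⟨huM, hu.2.2⟩
    · rintro ⟨huM, hu⟩
      exact ⟨(hMsub huM).1, (hMsub huM).2, hu⟩
  congr 2
  · rw [Finset.sum_boole, hfilter (c x) (c x₀) (hρS x hx) hρ0, Set.ncard_coe_finset]
  · rw [Finset.sum_boole, hfilter (c x₀) (c x) hρ0 (hρS x hx), Set.ncard_coe_finset]

/-! ## §4 The exact centring identities within the family -/

/-- **EXACT (dense) CENTRING on bond-`ℤ²` at `p = 1/2` within an invariant family**: for every
mesh `δ > 0`, every finite set `S` of medial cells, every NEUTRAL charge configuration `λ` on it and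
every family `T` invariant under isometric push-forwards and reversal,
`E_{1/2}[Σ_{u ∈ loops(X_δ ω) ∩ T} Σ_{F ∈ S : W(u, δ c_F) ≠ 0} λ_F] = 0`. -/
theorem bc_integral_finsum_phase_eq_zero_zEns
    (hT : ∀ (φ : C(ℂ, ℂ)) (hφ : Isometry φ) (u : UnbasedLoop ℂ), u.map φ hφ ∈ T ↔ u ∈ T)
    (hTr : ∀ u : UnbasedLoop ℂ, u.reverse ∈ T ↔ u ∈ T) {δ : ℝ} (hδ : 0 < δ)
    (S : Finset (ℤ × ℤ)) (lam : ℤ × ℤ → ℝ) (h0 : ∑ F ∈ S, lam F = 0) :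
    ∫ ω, (∑ᶠ u ∈ (zEns.X δ ω).loops ∩ T,
        ∑ F ∈ S, if u.wind ((δ : ℂ) * cellCenter F) ≠ 0 then lam F else 0) ∂zEns.P = 0 := by
  rcases S.eq_empty_or_nonempty with rfl | ⟨F₀, -⟩
  · simp
  simp_rw [bc_finsum_phase_eq_sum_ncard T hδ _ S (fun F ↦ (δ : ℂ) * cellCenter F) lam F₀ h0]
  rw [integral_finsetSum]
  · refine Finset.sum_eq_zero fun F _ ↦ ?_
    rw [integral_const_mul, integral_sub (bc_integrable_ncard_dipT T hδ _ _)
      (bc_integrable_ncard_dipT T hδ _ _), bc_integral_ncard_dipT_symm_cellCenter hT hTr δ F F₀,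
      sub_self, mul_zero]
  · intro F _
    exact ((bc_integrable_ncard_dipT T hδ _ _).sub (bc_integrable_ncard_dipT T hδ _ _)).const_mul (lam F)

/-- **SMEARED EXACT CENTRING on bond-`ℤ²` at mesh `δ` within an invariant family** (every
admissible neutral density; the family version of keystone K3 `smearedCentring_zEns`). -/
theorem bc_integral_finsum_nestingPhase_eq_zero_zEns
    (hT : ∀ (φ : C(ℂ, ℂ)) (hφ : Isometry φ) (u : UnbasedLoop ℂ), u.map φ hφ ∈ T ↔ u ∈ T)
    (hTr : ∀ u : UnbasedLoop ℂ, u.reverse ∈ T ↔ u ∈ T) {f : ℂ → ℝ} {R C δ : ℝ}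
    (hf : Measurable f) (hC : ∀ z, |f z| ≤ C) (hR : ∀ z, R < ‖z‖ → f z = 0) (h0 : ∫ z, f z = 0)
    (hδ : 0 < δ) :
    ∫ ω, (∑ᶠ u ∈ (zEns.X δ ω).loops ∩ T, ∫ z in {z : ℂ | u.wind z ≠ 0}, f z) ∂zEns.P = 0 := by
  have hN := SmearedCentringZ2.two_mul_div_add_two_le_ceil R δ
  have hcongr : ∀ ω : zEns.Ω,
      (∑ᶠ u ∈ (zEns.X δ ω).loops ∩ T, ∫ z in {z : ℂ | u.wind z ≠ 0}, f z) =
      ∑ᶠ u ∈ (zEns.X δ ω).loops ∩ T,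
        ∑ F ∈ Finset.Icc (-(⌈2 * R / δ + 2⌉₊ : ℤ)) ⌈2 * R / δ + 2⌉₊ ×ˢ
          Finset.Icc (-(⌈2 * R / δ + 2⌉₊ : ℤ)) ⌈2 * R / δ + 2⌉₊,
        if u.wind ((δ : ℂ) * cellCenter F) ≠ 0 then ∫ z in scaledCell δ F, f z else 0 :=
    fun ω ↦ finsum_mem_congr rfl fun u hu ↦
      SmearedCentringZ2.nestingPhase_eq_sum_cells hf hC hR hδ hN hu.1
  simp_rw [hcongr]
  exact bc_integral_finsum_phase_eq_zero_zEns hT hTr hδ _ _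
    (SmearedCentringZ2.sum_cellCharge_eq_zero hf hC hR h0 hδ hN)

end BandCentringZ2

/-- **Band centring on bond-`ℤ²`** (the `zEns` half of stub `stub_bandCentring`, line `Sketch`
v6, crux `MagicFormulaT`).  For every admissible neutral density `f` (measurable, `|f| ≤ C`,
`f = 0` off `‖z‖ ≤ R`, `∫ f = 0`), every mesh `δ > 0` and every cut-off `η`, the expected total
phase of the loops of critical bond percolation on `δℤ²` of trace-diameter `< η` vanishes EXACTLY:
`E_{1/2}[Σ_{u ∈ loops(X_δ ω), diam u < η} ∫_{W(u,·) ≠ 0} f] = 0` — the family `{diam < η}` is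
invariant under the isometries and the reversal by which the dipole symmetry acts. -/
theorem bc_bandCentring_zEns : ∀ (f : ℂ → ℝ) (R C δ η : ℝ), Measurable f →
    (∀ z, |f z| ≤ C) → (∀ z, R < ‖z‖ → f z = 0) → ∫ z, f z = 0 → 0 < δ →
    ∫ ω, (∑ᶠ u ∈ {u ∈ (zEns.X δ ω).loops | Metric.diam u.range < η}, u.nestingPhase f) ∂zEns.P = 0 := by
  intro f R C δ η hf hC hR h0 hδ
  have hT : ∀ (φ : C(ℂ, ℂ)) (hφ : Isometry φ) (u : UnbasedLoop ℂ),
      u.map φ hφ ∈ {u : UnbasedLoop ℂ | Metric.diam u.range < η} ↔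
        u ∈ {u : UnbasedLoop ℂ | Metric.diam u.range < η} := fun φ hφ u ↦ by
    simp only [Set.mem_setOf_eq, UnbasedLoop.range_map, hφ.diam_image]
  have hTr : ∀ u : UnbasedLoop ℂ, u.reverse ∈ {u : UnbasedLoop ℂ | Metric.diam u.range < η} ↔
      u ∈ {u : UnbasedLoop ℂ | Metric.diam u.range < η} := fun u ↦ by
    simp only [Set.mem_setOf_eq, UnbasedLoop.range_reverse]
  exact bc_integral_finsum_nestingPhase_eq_zero_zEns hT hTr hf hC hR h0 hδ

end Summit.CriticalPhenomena.CardyFormulaZ2.Cruxes.MagicFormulaT.LineSketch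

end
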